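import Literature.Analysis.Distribution.SchwartzLatticeSumCLM
import HarnessLib

/-!
# Lattice sums of a rapidly decreasing function under DILATION: `θ^k · ∑_{ℓ ∈ L ∖ 0} ‖f(θ ℓ)‖ → 0` as `θ → ∞`

Topic `Analysis/Distribution`; namespace `Literature.Analysis.Distribution` (sequel of ★ `SchwartzLatticeSum(CLM)`).
PROOF file (theorems only; no definition, no instance, no notation, no named fact, no `sorry`).  Cell `hodgecm-mathlib`
FLOOR 0, crux H413, E-2 ∕ SW2 identity road, gap **(G4)** «lattice tail sums under archimedean dilation» (E-2 lead finding
`E2-SW2c-FINDING.v0` §2 (ii) and F0P2a-p08 (g4)'s census §1 (b)∕§3 (G4): on the theta side of Weil's boundedness argument the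
terms are `Σ_{x ∈ M ∖ 0} θ^{k} Φ₀(θ x)` for a lattice `M` and a dominated Schwartz majorant `Φ₀`); B-p09 (g18).  HC_CM is proved
only modulo the printed citations until rung 0 closes — nothing here bears on a summit statement.

For a discrete subgroup `L` of a finite-dimensional real normed space `E` and a function `g : E → F` with polynomial decay
`‖g x‖ ≤ C (1 + ‖x‖)^{-m}`, `m ≥ rank L + 1`:

* `exists_pos_forall_norm_coe_ge` — a discrete subgroup has a uniform gap at `0`: `‖ℓ‖ ≥ δ_L > 0` for `ℓ ≠ 0`;
* **`exists_tsum_norm_dilate_le_of_decay`** — DILATED TAIL BOUND: `∑_{ℓ ∈ L ∖ 0} ‖g(θ ℓ)‖ ≤ C' θ^{-m}` for all `θ ≥ 1`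
  (with summability), `C' = C (δ∕(1+δ))^{-m} ∑_{ℓ ∈ L} (1+‖ℓ‖)^{-m}` — because `1 + θ‖ℓ‖ ≥ (δ∕(1+δ)) θ (1 + ‖ℓ‖)` off `ℓ = 0`
  and ★ `summable_one_add_norm_pow_inv`;
* **`tendsto_pow_mul_tsum_norm_dilate_of_decay`** — hence `θ^k ∑_{ℓ ≠ 0} ‖g(θ ℓ)‖ → 0` whenever `m ≥ rank L + 1` and `m > k`;
* **`SchwartzMap.tendsto_pow_mul_tsum_norm_dilate`** — for a Schwartz function and EVERY `k` (decay of every order from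
  ★ `SchwartzMap.norm_apply_add_le_mul_sup_seminorm`); the DOMINATED-FAMILY form (`‖Φ c x‖ ≤ g x` uniformly in a parameter `c`)
  is `exists_tsum_norm_dilate_le_of_decay`, whose constant depends only on `(C, m, L)` (`tsum_norm_dilate_le_of_dominated`).

The point `ℓ = 0` is excluded: there the term is the constant `‖g 0‖` and no power of `θ` kills it.

## References
* L. Grafakos, *Classical Fourier Analysis*, 3rd ed., GTM 249 (2014), §3.2.3, proof of Thm. 3.2.8 (the `(1+|x|)^{-n-δ}` lattice
  majorant). [Grafakos2014]
* A. Weil, *Sur la formule de Siegel dans la théorie des groupes classiques*, Acta Math. 113 (1965), n° 50 (boundedness on the torus: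
  the theta side under dilation). [folklore]
-/

noncomputable section

open scoped SchwartzMap Topology
open Filter

namespace Literature.Analysis.Distribution

variable {E F : Type*} [NormedAddCommGroup E] [NormedSpace ℝ E] [NormedAddCommGroup F] [NormedSpace ℝ F]

/-! ## §1 The uniform gap of a discrete subgroup at `0` -/

omit [NormedSpace ℝ E] in
/-- **A discrete subgroup has a uniform gap at `0`**: there is `δ > 0` with `δ ≤ ‖ℓ‖` for every `ℓ ∈ L ∖ 0`.
[cite: Grafakos2014, proof of Thm. 3.2.8] -/
theorem exists_pos_forall_norm_coe_ge (L : Submodule ℤ E) [DiscreteTopology L] :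
    ∃ δ : ℝ, 0 < δ ∧ ∀ ℓ : L, ℓ ≠ 0 → δ ≤ ‖(ℓ : E)‖ := by
  have h : IsOpen ({0} : Set L) := isOpen_discrete _
  obtain ⟨δ, hδ, hball⟩ := Metric.isOpen_iff.1 h 0 (Set.mem_singleton 0)
  refine ⟨δ, hδ, fun ℓ hℓ => ?_⟩
  by_contra hlt
  push Not at hlt
  have hmem : ℓ ∈ Metric.ball (0 : L) δ := by
    rw [Metric.mem_ball, dist_zero_right]
    exact hlt
  exact hℓ (hball hmem)

/-! ## §2 The dilated tail bound for a polynomially decreasing function -/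

/-- The elementary inequality behind the dilated tail bound: for `θ ≥ 1` and `‖x‖ ≥ δ > 0`,
`(δ∕(1+δ)) · θ · (1 + ‖x‖) ≤ 1 + ‖θ • x‖`. [folklore] -/
private theorem gap_mul_le_one_add_norm_smul {δ θ : ℝ} (hδ : 0 < δ) (hθ : 1 ≤ θ) {x : E} (hx : δ ≤ ‖x‖) :
    δ / (1 + δ) * θ * (1 + ‖x‖) ≤ 1 + ‖θ • x‖ := by
  have hθ0 : 0 ≤ θ := le_trans zero_le_one hθ
  rw [norm_smul, Real.norm_of_nonneg hθ0]
  have h1 : δ / (1 + δ) * (1 + ‖x‖) ≤ ‖x‖ := by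
    rw [div_mul_eq_mul_div, div_le_iff₀ (by linarith)]
    nlinarith [norm_nonneg x]
  calc δ / (1 + δ) * θ * (1 + ‖x‖) = θ * (δ / (1 + δ) * (1 + ‖x‖)) := by ring
    _ ≤ θ * ‖x‖ := mul_le_mul_of_nonneg_left h1 hθ0
    _ ≤ 1 + θ * ‖x‖ := by linarith [mul_nonneg hθ0 (norm_nonneg x)]

omit [NormedSpace ℝ F] in
/-- **THE DILATED TAIL BOUND.**  Let `L` be a discrete subgroup of a finite-dimensional real normed space and `g : E → F` with
`‖g x‖ ≤ C (1 + ‖x‖)^{-m}`, `m ≥ rank L + 1`.  Then there is `C' ≥ 0` such that for every `θ ≥ 1` the dilated lattice sum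
over `L ∖ 0` is summable and `∑_{ℓ ∈ L ∖ 0} ‖g(θ • ℓ)‖ ≤ C' · θ^{-m}`.  (Off `0`, `1 + θ‖ℓ‖ ≥ c θ (1 + ‖ℓ‖)` with
`c = δ_L∕(1+δ_L)`, so the dilated sum is dominated by `C (cθ)^{-m} ∑_L (1+‖ℓ‖)^{-m}`.) [cite: Grafakos2014, proof of Thm. 3.2.8] -/
theorem exists_tsum_norm_dilate_le_of_decay [FiniteDimensional ℝ E] (L : Submodule ℤ E) [DiscreteTopology L]
    {C : ℝ} (hC : 0 ≤ C) {m : ℕ} (hm : Module.finrank ℤ L + 1 ≤ m) :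
    ∃ C' : ℝ, 0 ≤ C' ∧ ∀ (g : E → F), (∀ x, ‖g x‖ ≤ C * ((1 + ‖x‖) ^ m)⁻¹) → ∀ θ : ℝ, 1 ≤ θ →
      Summable (fun ℓ : {ℓ : L // ℓ ≠ 0} => ‖g (θ • ((ℓ : L) : E))‖) ∧
        ∑' ℓ : {ℓ : L // ℓ ≠ 0}, ‖g (θ • ((ℓ : L) : E))‖ ≤ C' * (θ ^ m)⁻¹ := by
  obtain ⟨δ, hδ, hδL⟩ := exists_pos_forall_norm_coe_ge L
  set c : ℝ := δ / (1 + δ) with hc_def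
  have hc : 0 < c := div_pos hδ (by linarith)
  -- the summable weights `(1 + ‖ℓ‖)^{-m} ≤ (1 + ‖ℓ‖)^{-(rank L + 1)}`
  have hw : Summable fun ℓ : L => ((1 + ‖(ℓ : E)‖) ^ m)⁻¹ := by
    refine (summable_one_add_norm_pow_inv L).of_nonneg_of_le (fun _ => by positivity) fun ℓ => ?_
    exact inv_anti₀ (by positivity) (pow_le_pow_right₀ (by linarith [norm_nonneg (ℓ : E)]) hm)
  set S : ℝ := ∑' ℓ : L, ((1 + ‖(ℓ : E)‖) ^ m)⁻¹ with hS_def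
  have hS : 0 ≤ S := tsum_nonneg fun _ => by positivity
  refine ⟨C * (c ^ m)⁻¹ * S, by positivity, fun g hg θ hθ => ?_⟩
  have hθ0 : 0 < θ := lt_of_lt_of_le zero_lt_one hθ
  -- termwise bound off `0`
  have hb : ∀ ℓ : {ℓ : L // ℓ ≠ 0},
      ‖g (θ • ((ℓ : L) : E))‖ ≤ C * (c ^ m)⁻¹ * (θ ^ m)⁻¹ * ((1 + ‖((ℓ : L) : E)‖) ^ m)⁻¹ := by
    intro ℓ
    have hℓ : δ ≤ ‖((ℓ : L) : E)‖ := hδL ℓ.1 ℓ.2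
    have hkey := gap_mul_le_one_add_norm_smul (E := E) hδ hθ hℓ
    have hpos : 0 < c * θ * (1 + ‖((ℓ : L) : E)‖) := by positivity
    have hpow : (c * θ * (1 + ‖((ℓ : L) : E)‖)) ^ m ≤ (1 + ‖θ • ((ℓ : L) : E)‖) ^ m :=
      pow_le_pow_left₀ hpos.le hkey m
    calc ‖g (θ • ((ℓ : L) : E))‖ ≤ C * ((1 + ‖θ • ((ℓ : L) : E)‖) ^ m)⁻¹ := hg _
      _ ≤ C * ((c * θ * (1 + ‖((ℓ : L) : E)‖)) ^ m)⁻¹ :=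
          mul_le_mul_of_nonneg_left (inv_anti₀ (pow_pos hpos m) hpow) hC
      _ = C * (c ^ m)⁻¹ * (θ ^ m)⁻¹ * ((1 + ‖((ℓ : L) : E)‖) ^ m)⁻¹ := by
          rw [mul_pow, mul_pow, mul_inv, mul_inv]; ring
  -- the majorant, summable on all of `L`, hence on `L ∖ 0`
  have hmaj : Summable fun ℓ : L => C * (c ^ m)⁻¹ * (θ ^ m)⁻¹ * ((1 + ‖(ℓ : E)‖) ^ m)⁻¹ := hw.mul_left _
  have hmaj' : Summable fun ℓ : {ℓ : L // ℓ ≠ 0} =>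
      C * (c ^ m)⁻¹ * (θ ^ m)⁻¹ * ((1 + ‖((ℓ : L) : E)‖) ^ m)⁻¹ := hmaj.subtype _
  have hsum : Summable fun ℓ : {ℓ : L // ℓ ≠ 0} => ‖g (θ • ((ℓ : L) : E))‖ :=
    Summable.of_nonneg_of_le (fun _ => norm_nonneg _) hb hmaj'
  refine ⟨hsum, ?_⟩
  calc ∑' ℓ : {ℓ : L // ℓ ≠ 0}, ‖g (θ • ((ℓ : L) : E))‖
      ≤ ∑' ℓ : {ℓ : L // ℓ ≠ 0}, C * (c ^ m)⁻¹ * (θ ^ m)⁻¹ * ((1 + ‖((ℓ : L) : E)‖) ^ m)⁻¹ :=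
        hsum.tsum_le_tsum hb hmaj'
    _ ≤ ∑' ℓ : L, C * (c ^ m)⁻¹ * (θ ^ m)⁻¹ * ((1 + ‖(ℓ : E)‖) ^ m)⁻¹ :=
        Summable.tsum_subtype_le _ _ (fun _ => by positivity) hmaj
    _ = C * (c ^ m)⁻¹ * (θ ^ m)⁻¹ * S := by rw [hS_def, tsum_mul_left]
    _ = C * (c ^ m)⁻¹ * S * (θ ^ m)⁻¹ := by ring

omit [NormedSpace ℝ F] in
/-- **Dilated lattice tails of a polynomially decreasing function vanish to every order below the decay**:
`θ^k · ∑_{ℓ ∈ L ∖ 0} ‖g(θ • ℓ)‖ → 0` as `θ → ∞` when `‖g x‖ ≤ C (1+‖x‖)^{-m}` with `m ≥ rank L + 1` and `m > k`.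
[cite: Grafakos2014, proof of Thm. 3.2.8] -/
theorem tendsto_pow_mul_tsum_norm_dilate_of_decay [FiniteDimensional ℝ E] (L : Submodule ℤ E) [DiscreteTopology L]
    {g : E → F} {C : ℝ} (hC : 0 ≤ C) {m : ℕ} (hg : ∀ x, ‖g x‖ ≤ C * ((1 + ‖x‖) ^ m)⁻¹)
    (hm : Module.finrank ℤ L + 1 ≤ m) {k : ℕ} (hk : k < m) :
    Tendsto (fun θ : ℝ => θ ^ k * ∑' ℓ : {ℓ : L // ℓ ≠ 0}, ‖g (θ • ((ℓ : L) : E))‖) atTop (𝓝 0) := by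
  obtain ⟨C', hC', hbound⟩ := exists_tsum_norm_dilate_le_of_decay (F := F) L hC hm
  obtain ⟨n, rfl⟩ : ∃ n, m = k + (n + 1) := ⟨m - k - 1, by omega⟩
  -- squeeze between `0` and `C' θ^{-(n+1)}`
  have hlim : Tendsto (fun θ : ℝ => C' * (θ ^ (n + 1))⁻¹) atTop (𝓝 0) := by
    rw [← mul_zero C']
    exact (tendsto_inv_atTop_zero.comp (tendsto_pow_atTop (by omega))).const_mul C'
  refine squeeze_zero' ((eventually_ge_atTop 1).mono fun θ hθ => ?_) ((eventually_ge_atTop 1).mono fun θ hθ => ?_) hlim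
  · exact mul_nonneg (pow_nonneg (le_trans zero_le_one hθ) k) (tsum_nonneg fun _ => norm_nonneg _)
  · have hθ0 : 0 < θ := lt_of_lt_of_le zero_lt_one hθ
    have hθk : 0 < θ ^ k := pow_pos hθ0 k
    calc θ ^ k * ∑' ℓ : {ℓ : L // ℓ ≠ 0}, ‖g (θ • ((ℓ : L) : E))‖ ≤ θ ^ k * (C' * (θ ^ (k + (n + 1)))⁻¹) :=
          mul_le_mul_of_nonneg_left (hbound g hg θ hθ).2 hθk.le
      _ = C' * (θ ^ (n + 1))⁻¹ := by
          rw [pow_add, mul_inv]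
          field_simp

/-! ## §3 Schwartz functions and dominated families -/

/-- **Dilated lattice tails of a Schwartz function vanish to EVERY order**: for `f ∈ 𝓢(E, F)`, a discrete subgroup `L` and any
`k`, `θ^k · ∑_{ℓ ∈ L ∖ 0} ‖f(θ • ℓ)‖ → 0` as `θ → ∞` (the theta-side tail under archimedean dilation in Weil's boundedness
argument). [cite: Grafakos2014, proof of Thm. 3.2.8] -/
theorem SchwartzMap.tendsto_pow_mul_tsum_norm_dilate [FiniteDimensional ℝ E] (L : Submodule ℤ E) [DiscreteTopology L]
    (f : 𝓢(E, F)) (k : ℕ) :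
    Tendsto (fun θ : ℝ => θ ^ k * ∑' ℓ : {ℓ : L // ℓ ≠ 0}, ‖f (θ • ((ℓ : L) : E))‖) atTop (𝓝 0) := by
  set m : ℕ := k + (Module.finrank ℤ L + 1) with hm_def
  set S : ℝ := (Finset.Iic (m, 0)).sup (schwartzSeminormFamily ℝ E F) f with hS_def
  have hS : 0 ≤ S := apply_nonneg _ _
  have hg : ∀ x, ‖f x‖ ≤ 2 ^ m * S * ((1 + ‖x‖) ^ m)⁻¹ := fun x => by
    have h := SchwartzMap.norm_apply_add_le_mul_sup_seminorm ℝ m f 0 x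
    rw [zero_add, norm_zero, add_zero, one_pow, mul_one] at h
    calc ‖f x‖ ≤ 2 ^ m * ((1 + ‖x‖) ^ m)⁻¹ * S := h
      _ = 2 ^ m * S * ((1 + ‖x‖) ^ m)⁻¹ := by ring
  exact tendsto_pow_mul_tsum_norm_dilate_of_decay L (by positivity) hg (by omega) (by omega)

/-- **Schwartz tails, bound form**: for `f ∈ 𝓢(E, F)` and every `m ≥ rank L + 1` there is `C' ≥ 0` with
`∑_{ℓ ∈ L ∖ 0} ‖f(θ • ℓ)‖ ≤ C' θ^{-m}` for all `θ ≥ 1`. [cite: Grafakos2014, proof of Thm. 3.2.8] -/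
theorem SchwartzMap.exists_tsum_norm_dilate_le [FiniteDimensional ℝ E] (L : Submodule ℤ E) [DiscreteTopology L]
    (f : 𝓢(E, F)) {m : ℕ} (hm : Module.finrank ℤ L + 1 ≤ m) :
    ∃ C' : ℝ, 0 ≤ C' ∧ ∀ θ : ℝ, 1 ≤ θ →
      Summable (fun ℓ : {ℓ : L // ℓ ≠ 0} => ‖f (θ • ((ℓ : L) : E))‖) ∧
        ∑' ℓ : {ℓ : L // ℓ ≠ 0}, ‖f (θ • ((ℓ : L) : E))‖ ≤ C' * (θ ^ m)⁻¹ := by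
  set S : ℝ := (Finset.Iic (m, 0)).sup (schwartzSeminormFamily ℝ E F) f with hS_def
  have hS : 0 ≤ S := apply_nonneg _ _
  have hg : ∀ x, ‖f x‖ ≤ 2 ^ m * S * ((1 + ‖x‖) ^ m)⁻¹ := fun x => by
    have h := SchwartzMap.norm_apply_add_le_mul_sup_seminorm ℝ m f 0 x
    rw [zero_add, norm_zero, add_zero, one_pow, mul_one] at h
    calc ‖f x‖ ≤ 2 ^ m * ((1 + ‖x‖) ^ m)⁻¹ * S := h
      _ = 2 ^ m * S * ((1 + ‖x‖) ^ m)⁻¹ := by ring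
  obtain ⟨C', hC', hb⟩ := exists_tsum_norm_dilate_le_of_decay (F := F) L (C := 2 ^ m * S) (by positivity) hm
  exact ⟨C', hC', hb _ hg⟩

omit [NormedSpace ℝ F] in
/-- **Dominated families**: if a family `Φ c` (`c` in any parameter set) is uniformly polynomially decreasing,
`‖Φ c x‖ ≤ C (1+‖x‖)^{-m}` with `m ≥ rank L + 1` (e.g. dominated by one rapidly decreasing majorant), then ONE constant bounds
all dilated tails: `∑_{ℓ ∈ L ∖ 0} ‖Φ c (θ • ℓ)‖ ≤ C' θ^{-m}` for all `c` and all `θ ≥ 1` — the constant of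
`exists_tsum_norm_dilate_le_of_decay` depends only on `C`, `m`, `L`. [cite: Grafakos2014, proof of Thm. 3.2.8] -/
theorem tsum_norm_dilate_le_of_dominated [FiniteDimensional ℝ E] (L : Submodule ℤ E) [DiscreteTopology L]
    {ι' : Type*} {Φ : ι' → E → F} {C : ℝ} (hC : 0 ≤ C) {m : ℕ}
    (hΦ : ∀ c x, ‖Φ c x‖ ≤ C * ((1 + ‖x‖) ^ m)⁻¹) (hm : Module.finrank ℤ L + 1 ≤ m) :
    ∃ C' : ℝ, 0 ≤ C' ∧ ∀ (c : ι') (θ : ℝ), 1 ≤ θ →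
      Summable (fun ℓ : {ℓ : L // ℓ ≠ 0} => ‖Φ c (θ • ((ℓ : L) : E))‖) ∧
        ∑' ℓ : {ℓ : L // ℓ ≠ 0}, ‖Φ c (θ • ((ℓ : L) : E))‖ ≤ C' * (θ ^ m)⁻¹ := by
  obtain ⟨C', hC', hb⟩ := exists_tsum_norm_dilate_le_of_decay (F := F) L hC hm
  exact ⟨C', hC', fun c => hb (Φ c) (hΦ c)⟩

end Literature.Analysis.Distribution

end
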